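import Summits.QuantumAdvantage.QuantumAdvantage.Theorems.CubicForrelationNearExactIsExactEighteenTypeOBoundary
import Summits.QuantumAdvantage.QuantumAdvantage.Theorems.CubicForrelationNearExactIsExactEighteenLevelSeven
import Summits.QuantumAdvantage.QuantumAdvantage.Theorems.CubicForrelationNearExactIsExactEighteenLevelEight
import Summits.QuantumAdvantage.QuantumAdvantage.Theorems.CubicForrelationNearExactIsExactFourteenBoundary

/-!
# Crux `CubicForrelation.NearExactIsExact` (stmt-QuantumAdvantage-14043) — n = 18: the boundary value `63/64` is NOT attained;
  `Φ ≥ 63/64 ⇒ Φ = 1` for cubic pairs on 18 bits, so `θ₁₈ ∈ [15/16, 63/64)`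

Certificate seat `b2b-cforr-cert` (gen 6).  HONEST FRAMING: a DECIDABLE VERDICT about the finite slice `n = 18` of the crux, obtained by a
TWO-SIDED (partner-using) argument above the one-sided ladder — NOT summit progress (the crux needs one `θ < 1` for all `n`).

The tree had `θ₁₈ ∈ [15/16, 63/64]` (`theta_eighteen_bounds`, certificate seat gen 3: one-sided capacity).  ASSEMBLY (`eb_isolation_eighteen_ge`):
write `W_g = 64u` (Ax); on 18 bits the level-6 parity is constant (`ei_typeO_of_exists_odd`).
* type O (all `u` odd): `Φ < 63/64` (`et_typeO_eighteen_lt`: `d₁` affine, the deviation set a 15-flat, few frequencies vs the pairing `2²⁴`);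
* all `u` even, some `u/2` odd (level 7): impossible at `Φ ≥ 63/64` (`el7_levelSeven_false`: hyperplane + engine `fl1_flat_l1`);
* `W_g ∈ 256ℤ` (level `≥ 8`): `Φ = 1` (`el8_levelEight_ge`: 15-flat + engine, or the bent endgame).
Hence `isolation_eighteen_closed` (at the literal type `Fin 18`), `theta_eighteen_lt`, and `theta_eighteen_halfopen`: the least isolation constant
satisfies `15/16 ≤ θ₁₈ < 63/64`.  The window `(15/16, 63/64)` remains open.

References: as in the imported files (Ax/McEliece, MacWilliams–Sloane Ch. 13–15, Hou 1998, O'Donnell 2014 §3.3, Aaronson–Ambainis 2018 §1.1.1).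
Everything below is proved from Mathlib and the tree; axioms are the standard three.
-/

set_option linter.dupNamespace false -- D-0017: single-problem summit ⇒ `QuantumAdvantage.QuantumAdvantage` by design

noncomputable section

namespace Summit.QuantumAdvantage.QuantumAdvantage.Theorems.CubicForrelation.NearExactIsExact

open Finset
open Literature.Computability.QuantumComplexity
open Literature.Computability.QuantumComplexity.DerivativeWalsh (W)

/-- **`Φ ≥ 63/64 ⇒ Φ = 1` for cubic pairs on `9 + 9` bits** (the assembly described in the header). [this work] -/
theorem eb_isolation_eighteen_ge (f g : (Fin (9 + 9) → Bool) → Bool) (hf : IsDegLeFun 3 f) (hg : IsDegLeFun 3 g)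
    (hΦ : (63 / 64 : ℝ) ≤ forrelation f g) : forrelation f g = 1 := by
  obtain ⟨u₆, hu₆⟩ := tw_base g hg 6 (by norm_num)
  by_cases hodd : ∃ x, Odd (u₆ x)
  · -- type O
    have hall := ei_typeO_of_exists_odd g u₆ hg hu₆ hodd
    exact absurd hΦ (not_le.2 (et_typeO_eighteen_lt f g hf hg u₆ hu₆ hall))
  · push Not at hodd
    have hu₇ := tw_level_up g u₆ hu₆ hodd
    by_cases hodd7 : ∃ x, Odd (u₆ x / 2)
    · exact (el7_levelSeven_false f g hf hg (fun x => u₆ x / 2) hu₇ hodd7 hΦ).elim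
    · push Not at hodd7
      have hu₈ := tw_level_up g (fun x => u₆ x / 2) hu₇ hodd7
      exact el8_levelEight_ge f g hf hg _ hu₈ hΦ

/-- **The boundary value `63/64` is not attained on 18 bits: `Φ(f,g) ≥ 63/64 ⇒ Φ(f,g) = 1` for all cubic `f, g : 𝔽₂¹⁸ → 𝔽₂`** (at the
literal type `Fin 18`).  Improves `isolation_eighteen_63_64` (`>`) to `≥`; the improvement is two-sided (it uses the partner `f`).
Finite-slice verdict; NOT summit progress. [this work] -/
theorem isolation_eighteen_closed : ∀ f g : (Fin 18 → Bool) → Bool, IsDegLeFun 3 f → IsDegLeFun 3 g →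
    (63 / 64 : ℝ) ≤ forrelation f g → forrelation f g = 1 :=
  fun f g hf hg h => eb_isolation_eighteen_ge f g hf hg h

/-- **`θ₁₈ < 63/64`: some constant strictly below `63/64` already isolates exactness for cubic pairs on 18 bits.**  Finite-slice verdict; NOT
summit progress. [this work] -/
theorem theta_eighteen_lt : ∃ θ : ℝ, θ < 63 / 64 ∧ ∀ f g : (Fin 18 → Bool) → Bool, IsDegLeFun 3 f → IsDegLeFun 3 g →
    θ < forrelation f g → forrelation f g = 1 :=
  fb_theta_lt_of_closed (n := 18) (63 / 64) isolation_eighteen_closed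

/-- **`θ₁₈ ∈ [15/16, 63/64)`** — the `n = 18` row of the ladder with a HALF-OPEN upper end: the least isolation constant `θ₁₈` for cubic pairs
on 18 bits exists, is at least `15/16` (attained, `theta_eighteen_bounds`) and is STRICTLY below the one-sided constant `63/64` (`theta_eighteen_lt`).
The window `(15/16, 63/64)` remains open.  Finite-slice verdict; NOT summit progress. [this work] -/
theorem theta_eighteen_halfopen : ∃ θ₀ : ℝ, 15 / 16 ≤ θ₀ ∧ θ₀ < 63 / 64 ∧
    IsLeast {θ : ℝ | ∀ f g : (Fin 18 → Bool) → Bool, IsDegLeFun 3 f → IsDegLeFun 3 g →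
      θ < forrelation f g → forrelation f g = 1} θ₀ := by
  obtain ⟨θ₀, hθ₀⟩ := theta_exists 18
  obtain ⟨θ', hθ', hiso⟩ := theta_eighteen_lt
  exact ⟨θ₀, theta_eighteen_bounds.2 θ₀ hθ₀.1, lt_of_le_of_lt (hθ₀.2 hiso) hθ', hθ₀⟩

/-- **No cubic pair on 18 bits has `63/64 ≤ Φ < 1`** (the closed boundary window is empty). [this work] -/
theorem no_boundary_window_eighteen : ¬ ∃ f g : (Fin 18 → Bool) → Bool, IsDegLeFun 3 f ∧ IsDegLeFun 3 g ∧
    (63 / 64 : ℝ) ≤ forrelation f g ∧ forrelation f g < 1 := by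
  rintro ⟨f, g, hf, hg, hge, hlt⟩
  exact absurd (isolation_eighteen_closed f g hf hg hge) (ne_of_lt hlt)

end Summit.QuantumAdvantage.QuantumAdvantage.Theorems.CubicForrelation.NearExactIsExact

end
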